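import Literature.Analysis.FluidPDE.OnsagerBDSVStationaryPhaseIBP
import Literature.Analysis.FluidPDE.AntidivergenceHolder
import Literature.Analysis.FluidPDE.OnsagerBDSVPotentialTheoryProofs
import Literature.Analysis.FluidPDE.AntidivergenceLinear
import Literature.Analysis.FunctionSpaces.ContDiffHolderLeibniz
import Literature.Analysis.FunctionSpaces.HolderScaleInterpolation
import Literature.Analysis.FunctionSpaces.TorusFourierCalculus
import HarnessLib

/-!
# BDSV stationary phase, III: the real telescoping identity and the reduction of the `ℛ` estimate

Buckmaster–De Lellis–Székelyhidi–Vicol 2019, App. C, Prop. C.2, second part (the named fact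
`BDSV.antidivergencePhaseBound` of `OnsagerBDSVStationaryPhase.lean`):
`‖ℛ(a e^{ik·Φ})‖_α ≲ ‖a‖₀/|k|^{1-α} + (‖a‖_{N+α} + ‖a‖₀‖Φ‖_{N+α})/|k|^{N-α}`. The printed proof
is that of Daneri–Székelyhidi 2017, Lemma 2.2 (ii): with `a₀ = a`, `aₙ = -div(aₙ₋₁ ∇φ/|∇φ|²)`,

  `a₀ e^{iλφ} = Σ_{n<N} div(aₙ ∇φ/|∇φ|² e^{iλφ}) (iλ)^{-(n+1)} + (iλ)^{-N} a_N e^{iλφ}`,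

then Schauder ("`ℛ div` and `ℛ` are bounded on `C^α`") term by term, and the tame bounds
`[a_N ∇φ/|∇φ|²]_s ≤ C([a]_{N+s} + ‖a‖₀[∇φ]_{N+s})` with interpolation. This file carries out, for
the tree's transcription (phase `ψ = θ + 2π m·Φ`, `Φ = id + D` on `T³ = (ℝ/ℤ)³`, real phase factor
`cos_θ := BDSV.phaseCos m D θ = cos ψ`, field `F = ∇ψ/|∇ψ|² = BDSV.ibpField` — the factor
`λ⁻¹ = (2π|m|)⁻¹` is built into `F` — and operator `L b = Σⱼ ∂ⱼ(b Fⱼ) = BDSV.ibpOp` of parts I–II),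
everything in this proof EXCEPT the bounds on the iterates `Lⁿ a`:

* the **real telescoping identity** (no complex amplitudes are needed because `ℛ` is real-linear
  and the phase shifts stay inside the family `cos_θ`): `∂ⱼ cos_θ = 2π|m| dirVecⱼ cos_{θ+π/2}`
  (`BDSV.partialDeriv_phaseCos`), `Σⱼ Fⱼ ∂ⱼ cos_{θ-π/2} = cos_θ`, whence for smooth scalar `b`
  `b cos_θ = Σⱼ ∂ⱼ(b Fⱼ cos_{θ-π/2}) + (L b) cos_{θ+π/2}` (`BDSV.mul_phaseCos_eq`); for vector
  amplitudes, with `L` acting componentwise (`BDSV.ibpOpVec`) and the mode tensor with columns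
  `(Fₗ cos_{θ'}) • b` (`BDSV.modeTensor`, so that its `Torus.tensorDivergence` is `div((F cos) ⊗ b)`),
  `cos_θ • a = Σ_{n<N} div(modeTensor_{θ+nπ/2-π/2}(Lⁿa)) + cos_{θ+Nπ/2} • Lᴺ a`
  (`BDSV.phaseCos_smul_eq_sum`);
* the **Schauder step**: `ℛ` of the telescoped sum by linearity (`Torus.antidivergence_add`) and
  the two PROVED operator bounds of `AntidivergenceHolder.lean` (`‖ℛ div A‖_{0,α} ≤ C_d ‖A‖_{0,α}`,
  `‖ℛ v‖_{0,α} ≤ C_r ‖v‖_{0,α}`, from `BDSV.holderCZBound_holds`):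
  `BDSV.antidivergence_phaseCos_smul_le`;
* the **order-zero bookkeeping** of the factors outside `Lⁿ a`: the sharp product rule
  `‖f • g‖_{0,r} ≤ ‖f‖_∞‖g‖_{0,r} + ‖f‖_{0,r}‖g‖_∞`, columns of a tensor, `‖cos_θ‖_{0,α} ≤ (2πĈ+3)|m|^α`
  (Lipschitz constant `2π|m|Ĉ` of the lift interpolated against the oscillation `2` at scale
  `|m|⁻¹`, `holderWith_of_lipschitzWith_of_edist_le`), `‖Fₗ‖_∞ ≤ Ĉ/(2π|m|)` and
  `‖Fₗ‖_{0,r} ≤ (2π|m|)⁻¹(Ĉ + 3Ĉ⁴ ‖D‖_{1,r})` (`v ↦ v/|v|²` is `3Ĉ⁴`-Lipschitz on the shell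
  `Ĉ⁻¹ ≤ |v| ≤ Ĉ`);
* the **hand-off** `BDSV.antidivergence_phaseCos_smul_le_iterates` (and its instance
  `BDSV.antidivergence_phaseCos_smul_le_iterates'` with the proved operator constants):
  `‖ℛ(cos_θ a)‖_{0,α} ≤ C_d Σ_{n<N} Σₗ (c Ĉ ‖Lⁿa‖_{0,α} + (c Ĉ (2πĈ+3)|m|^α + c (Ĉ + 3Ĉ⁴‖D‖_{1,α})) ‖Lⁿa‖_∞)
  + C_r (‖Lᴺa‖_{0,α} + (2πĈ+3)|m|^α ‖Lᴺa‖_∞)`, `c = (2π|m|)⁻¹`.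

What is NOT here (the remaining content of the discharge of `BDSV.antidivergencePhaseBound`):
Daneri–Székelyhidi's tame bound (E:a_N2) for the iterates in the two norms used above,
`‖Lⁿa‖_{0,s} ≤ C(Ĉ,n) |m|^{-n} (‖a‖_{n,s} + ‖a‖₀(1 + ‖D‖_{n+1,s}))`, `s ∈ {0, α}` (sharp Leibniz rule at
order `k`, tame reciprocal `1/|dirVec|²`, induction on `n`), and the final interpolation at scale
`|m|⁻¹` (`Torus.eContDiffHolderNorm_le_interp_of_le_one`, `Torus.eContDiffHolderNorm_mul_le_mixed_tame`).
The vector iterates reduce to the scalar ones of part II componentwise (`BDSV.iterate_ibpOpVec_apply`).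

## References

* T. Buckmaster, C. De Lellis, L. Székelyhidi Jr., V. Vicol, *Onsager's conjecture for admissible
  weak solutions*, CPAM 72 (2019) = arXiv:1701.08678, App. C, Prop. C.2. [`BuckmasterEtAl2018`]
* S. Daneri, L. Székelyhidi Jr., *Non-uniqueness and h-principle for Hölder-continuous weak
  solutions of the Euler equations*, ARMA 224 (2017) = arXiv:1603.09714, Lemma 2.2 (ii) and its
  proof (the telescoping identity, the Schauder step). [`DaneriSzekelyhidi2017`]
-/

noncomputable section

open Set MeasureTheory Complex
open scoped NNReal ENNReal ContDiff InnerProductSpace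

namespace Literature.Analysis.FluidPDE

namespace BDSV

open FunctionSpaces FunctionSpaces.Torus

/-- The flat three-torus `T³ = (ℝ/ℤ)³`, local notation. -/
local notation "𝕋³" => UnitAddTorus (Fin 3)

/-- Euclidean `ℝ³`, local notation. -/
local notation "ℝ³" => EuclideanSpace ℝ (Fin 3)

variable {Ĉ : ℝ} {D : 𝕋³ → ℝ³} {m : Fin 3 → ℤ} {θ : ℝ}

/-- A phase shift by `π/2` multiplies the phase factor by `i`: `e^{i(θ+π/2)}E = i e^{iθ}E`. [folklore] -/
theorem phaseFactor_add_pi_div_two (m : Fin 3 → ℤ) (D : 𝕋³ → ℝ³) (θ : ℝ) (x : 𝕋³) :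
    phaseFactor m D (θ + Real.pi / 2) x = Complex.I * phaseFactor m D θ x := by
  rw [phaseFactor, phaseFactor, ← mul_assoc]
  congr 1
  push_cast
  rw [add_mul, Complex.exp_add, Complex.exp_pi_div_two_mul_I, mul_comm]

/-- A phase shift by `π` negates the real phase factor: `cos(ψ + π) = -cos ψ`. [folklore] -/
theorem phaseCos_add_pi (m : Fin 3 → ℤ) (D : 𝕋³ → ℝ³) (θ : ℝ) (x : 𝕋³) :
    phaseCos m D (θ + Real.pi) x = -phaseCos m D θ x := by
  rw [phaseCos_eq_re_phaseFactor, phaseCos_eq_re_phaseFactor,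
    show θ + Real.pi = θ + Real.pi / 2 + Real.pi / 2 by ring, phaseFactor_add_pi_div_two,
    phaseFactor_add_pi_div_two, ← mul_assoc, Complex.I_mul_I, neg_one_mul, Complex.neg_re]

/-- **Derivative of the real phase factor**: `∂ⱼ cos(ψ + θ) = (2π|m| dirVecⱼ) cos(ψ + θ + π/2)`
(`= -∂ⱼψ sin(ψ+θ)`, from `∂ⱼE = i ∂ⱼψ E`, `BDSV.partialDeriv_phaseFactor`). [folklore] -/
theorem partialDeriv_phaseCos (hD : IsSmooth D) (j : Fin 3) (x : 𝕋³) :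
    Torus.partialDeriv j (phaseCos m D θ) x =
      (2 * Real.pi * ‖latticeVec m‖ * dirVec m D x j) * phaseCos m D (θ + Real.pi / 2) x := by
  have hE : IsSmooth (phaseFactor m D θ) := isSmooth_phaseFactor m θ hD
  have hfun : phaseCos m D θ = (Complex.reCLM : ℂ →L[ℝ] ℝ) ∘ phaseFactor m D θ := by
    funext y; rfl
  rw [hfun, partialDeriv_clm_comp hE, partialDeriv_phaseFactor hD j x, phaseCos_eq_re_phaseFactor,
    phaseFactor_add_pi_div_two]
  simp only [Complex.reCLM_apply, Complex.mul_re, Complex.ofReal_re, Complex.ofReal_im,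
    Complex.I_re, Complex.I_im, Complex.mul_im]
  ring

/-- **The key identity** `∑ⱼ Fⱼ ∂ⱼ cos(ψ + θ - π/2) = cos(ψ + θ)` (`F·∇ψ = 1`,
`BDSV.sum_ibpField_mul`). [cite: DaneriSzekelyhidi2017, Lemma 2.2 (proof)] -/
theorem sum_ibpField_mul_partialDeriv_phaseCos (hĈ : 1 ≤ Ĉ) (hD : IsSmooth D)
    (hND : IsNondegenerateDisplacement Ĉ D) (hm : m ≠ 0) (θ : ℝ) (x : 𝕋³) :
    ∑ j, ibpField m D j x * Torus.partialDeriv j (phaseCos m D (θ - Real.pi / 2)) x =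
      phaseCos m D θ x := by
  simp only [partialDeriv_phaseCos hD, sub_add_cancel]
  have hkey := sum_ibpField_mul (D := D) hm (dirVec_ne_zero hĈ hND hm x)
  calc ∑ j, ibpField m D j x * ((2 * Real.pi * ‖latticeVec m‖ * dirVec m D x j) * phaseCos m D θ x)
      = (∑ j, ibpField m D j x * (2 * Real.pi * ‖latticeVec m‖ * dirVec m D x j)) *
          phaseCos m D θ x := by
        rw [Finset.sum_mul]
        exact Finset.sum_congr rfl fun j _ => by ring
    _ = phaseCos m D θ x := by rw [hkey, one_mul]

/-- **One real integration by parts, pointwise** (the inductive step of the telescoping identity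
of Daneri–Székelyhidi, `a e^{iλφ} = (iλ)⁻¹(div(a ∇φ/|∇φ|² e^{iλφ}) + a₁ e^{iλφ})`, real form): for
smooth scalar `b`, `b cos(ψ+θ) = ∑ⱼ ∂ⱼ(b Fⱼ cos(ψ+θ-π/2)) + (L b) cos(ψ+θ+π/2)` (`L = BDSV.ibpOp`
carries no sign; the signs are phase shifts). [cite: DaneriSzekelyhidi2017, Lemma 2.2 (proof)] -/
theorem mul_phaseCos_eq (hĈ : 1 ≤ Ĉ) (hD : IsSmooth D) (hND : IsNondegenerateDisplacement Ĉ D)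
    (hm : m ≠ 0) (θ : ℝ) {b : 𝕋³ → ℝ} (hb : IsSmooth b) (x : 𝕋³) :
    b x * phaseCos m D θ x =
      (∑ j, Torus.partialDeriv j
          (fun y => b y * ibpField m D j y * phaseCos m D (θ - Real.pi / 2) y) x) +
        ibpOp m D b x * phaseCos m D (θ + Real.pi / 2) x := by
  set θ' := θ - Real.pi / 2 with hθ'
  have hpc : IsSmooth (phaseCos m D θ') := isSmooth_phaseCos m hD θ'
  have hp : ∀ j, IsSmooth (fun y => b y * ibpField m D j y) := fun j =>
    isSmooth_mul hb (isSmooth_ibpField hĈ hD hND hm j)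
  have hprod : ∀ j, Torus.partialDeriv j (fun y => b y * ibpField m D j y * phaseCos m D θ' y) x =
      b x * ibpField m D j x * Torus.partialDeriv j (phaseCos m D θ') x +
        Torus.partialDeriv j (fun y => b y * ibpField m D j y) x * phaseCos m D θ' x := fun j =>
    partialDeriv_mul ((hp j).isContDiff (by simp)) (hpc.isContDiff (by simp)) j x
  simp only [hprod, Finset.sum_add_distrib]
  have h1 : ∑ j, b x * ibpField m D j x * Torus.partialDeriv j (phaseCos m D θ') x =
      b x * phaseCos m D θ x := by
    have := sum_ibpField_mul_partialDeriv_phaseCos hĈ hD hND hm θ x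
    rw [← hθ'] at this
    rw [← this, Finset.mul_sum]
    exact Finset.sum_congr rfl fun j _ => by ring
  have h2 : ∑ j, Torus.partialDeriv j (fun y => b y * ibpField m D j y) x * phaseCos m D θ' x =
      ibpOp m D b x * phaseCos m D θ' x := by
    rw [ibpOp, Finset.sum_mul]
  have h3 : phaseCos m D (θ + Real.pi / 2) x = -phaseCos m D θ' x := by
    rw [hθ', show θ + Real.pi / 2 = θ - Real.pi / 2 + Real.pi by ring, phaseCos_add_pi]
  rw [h1, h2, h3]
  ring

/-! ### Vector amplitudes: `L` componentwise, the mode tensor, telescoping -/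

/-- The operator `L` on vector amplitudes, componentwise: `(L a)ᵢ = L(aᵢ) = Σⱼ ∂ⱼ(aᵢ Fⱼ)`
(`BDSV.ibpOp`). [cite: DaneriSzekelyhidi2017, Lemma 2.2 (proof)] -/
def ibpOpVec (m : Fin 3 → ℤ) (D : 𝕋³ → ℝ³) (a : 𝕋³ → ℝ³) (x : 𝕋³) : ℝ³ :=
  WithLp.toLp 2 fun i => ibpOp m D (fun y => a y i) x

/-- The **mode tensor** `(F cos(ψ+θ')) ⊗ b`, stored by columns as in `Torus.tensorDivergence`:
column `l` is `(Fₗ cos(ψ + θ')) • b`, so that `div(modeTensor) = Σₗ ∂ₗ(Fₗ cos(ψ+θ') b)`.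
[cite: DaneriSzekelyhidi2017, Lemma 2.2 (proof)] -/
def modeTensor (m : Fin 3 → ℤ) (D : 𝕋³ → ℝ³) (θ' : ℝ) (b : 𝕋³ → ℝ³) (y : 𝕋³) (l : Fin 3) : ℝ³ :=
  (ibpField m D l y * phaseCos m D θ' y) • b y

/-- `L a` is smooth for smooth `a` (and a smooth non-degenerate displacement). [folklore] -/
theorem isSmooth_ibpOpVec (hĈ : 1 ≤ Ĉ) (hD : IsSmooth D) (hND : IsNondegenerateDisplacement Ĉ D)
    (hm : m ≠ 0) {a : 𝕋³ → ℝ³} (ha : IsSmooth a) : IsSmooth (ibpOpVec m D a) := by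
  unfold IsSmooth
  rw [contDiff_euclidean]
  intro i
  exact isSmooth_ibpOp hĈ hD hND hm (ha.apply i)

/-- The vector iterates `Lⁿ a` are smooth. [folklore] -/
theorem isSmooth_iterate_ibpOpVec (hĈ : 1 ≤ Ĉ) (hD : IsSmooth D)
    (hND : IsNondegenerateDisplacement Ĉ D) (hm : m ≠ 0) {a : 𝕋³ → ℝ³} (ha : IsSmooth a) :
    ∀ n : ℕ, IsSmooth ((ibpOpVec m D)^[n] a)
  | 0 => ha
  | n + 1 => by
      rw [Function.iterate_succ_apply']
      exact isSmooth_ibpOpVec hĈ hD hND hm (isSmooth_iterate_ibpOpVec hĈ hD hND hm ha n)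

/-- The mode tensor of a smooth amplitude is smooth. [folklore] -/
theorem isSmooth_modeTensor (hĈ : 1 ≤ Ĉ) (hD : IsSmooth D) (hND : IsNondegenerateDisplacement Ĉ D)
    (hm : m ≠ 0) (θ' : ℝ) {b : 𝕋³ → ℝ³} (hb : IsSmooth b) : IsSmooth (modeTensor m D θ' b) := by
  unfold IsSmooth
  rw [contDiff_pi]
  intro l
  exact (isSmooth_mul (isSmooth_ibpField hĈ hD hND hm l) (isSmooth_phaseCos m hD θ')).smul' hb

/-- **One real integration by parts, vector form**:
`cos(ψ+θ) b = div((F cos(ψ+θ-π/2)) ⊗ b) + cos(ψ+θ+π/2) L b` for smooth `b : T³ → ℝ³`.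
[cite: DaneriSzekelyhidi2017, Lemma 2.2 (proof)] -/
theorem phaseCos_smul_eq (hĈ : 1 ≤ Ĉ) (hD : IsSmooth D) (hND : IsNondegenerateDisplacement Ĉ D)
    (hm : m ≠ 0) (θ : ℝ) {b : 𝕋³ → ℝ³} (hb : IsSmooth b) (x : 𝕋³) :
    phaseCos m D θ x • b x =
      Torus.tensorDivergence (modeTensor m D (θ - Real.pi / 2) b) x +
        phaseCos m D (θ + Real.pi / 2) x • ibpOpVec m D b x := by
  have hcol : ∀ l, IsContDiff 1 (fun y => modeTensor m D (θ - Real.pi / 2) b y l) := fun l =>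
    ((isSmooth_mul (isSmooth_ibpField hĈ hD hND hm l)
      (isSmooth_phaseCos m hD _)).smul' hb).isContDiff (by simp)
  ext i
  have h := mul_phaseCos_eq hĈ hD hND hm θ (hb.apply i) x
  simp only [Torus.tensorDivergence, PiLp.add_apply, PiLp.smul_apply, smul_eq_mul, ibpOpVec,
    WithLp.ofLp_sum, Finset.sum_apply]
  rw [mul_comm, h]
  congr 1
  · refine Finset.sum_congr rfl fun l _ => ?_
    rw [← partialDeriv_apply_coord (hcol l) l x i]
    congr 1
    funext y
    simp only [modeTensor, PiLp.smul_apply, smul_eq_mul]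
    ring
  · ring

/-- **The telescoping identity** (Daneri–Székelyhidi, proof of Lemma 2.2: "It follows by induction
on `N` that `a₀e^{iλφ} = Σ_{n<N} div(aₙ∇φ/|∇φ|² e^{iλφ})(iλ)^{-(n+1)} + (iλ)^{-N} a_N e^{iλφ}`"), real
form: for every `N`,
`cos(ψ+θ) a = ∑_{n<N} div((F cos(ψ+θ+nπ/2-π/2)) ⊗ Lⁿa) + cos(ψ+θ+Nπ/2) Lᴺ a`.
[cite: DaneriSzekelyhidi2017, Lemma 2.2 (proof)] -/
theorem phaseCos_smul_eq_sum (hĈ : 1 ≤ Ĉ) (hD : IsSmooth D)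
    (hND : IsNondegenerateDisplacement Ĉ D) (hm : m ≠ 0) (θ : ℝ) {a : 𝕋³ → ℝ³} (ha : IsSmooth a) :
    ∀ (N : ℕ) (x : 𝕋³), phaseCos m D θ x • a x =
      (∑ n ∈ Finset.range N, Torus.tensorDivergence
          (modeTensor m D (θ + n * (Real.pi / 2) - Real.pi / 2) ((ibpOpVec m D)^[n] a)) x) +
        phaseCos m D (θ + N * (Real.pi / 2)) x • ((ibpOpVec m D)^[N] a) x
  | 0, x => by simp
  | N + 1, x => by
      rw [phaseCos_smul_eq_sum hĈ hD hND hm θ ha N x, Finset.sum_range_succ,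
        phaseCos_smul_eq hĈ hD hND hm _ (isSmooth_iterate_ibpOpVec hĈ hD hND hm ha N) x,
        Function.iterate_succ_apply']
      have h1 : θ + (N : ℝ) * (Real.pi / 2) + Real.pi / 2 = θ + ((N + 1 : ℕ) : ℝ) * (Real.pi / 2) := by
        push_cast; ring
      rw [h1]
      abel

/-! ### The Hölder norm of the phase factor: `‖cos(ψ + θ)‖_{C^{0,α}} ≤ (2πĈ + 3) |m|^α` -/

/-- The lifted real phase factor `y ↦ cos ψ(y)` is `2π|m|Ĉ`-Lipschitz on `ℝ³`
(`|∇ψ| = 2π|m| |dirVec| ≤ 2π|m|Ĉ`). [folklore] -/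
theorem lipschitzWith_lift_phaseCos (hĈ : 1 ≤ Ĉ) (hD : IsSmooth D)
    (hND : IsNondegenerateDisplacement Ĉ D) (hm : m ≠ 0) (θ : ℝ) :
    LipschitzWith (Real.toNNReal (2 * Real.pi * ‖latticeVec m‖ * Ĉ)) (lift (phaseCos m D θ)) := by
  have hE : IsSmooth (phaseFactor m D θ) := isSmooth_phaseFactor m θ hD
  have hEd : Differentiable ℝ (lift (phaseFactor m D θ)) := hE.differentiable (by simp)
  have hlift : lift (phaseCos m D θ) = (Complex.reCLM : ℂ →L[ℝ] ℝ) ∘ lift (phaseFactor m D θ) := rfl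
  have hC : 0 < Ĉ := lt_of_lt_of_le one_pos hĈ
  have hC0 : 0 ≤ 2 * Real.pi * ‖latticeVec m‖ * Ĉ := by positivity
  rw [hlift]
  have hre : LipschitzWith 1 (Complex.reCLM : ℂ →L[ℝ] ℝ) := by
    simpa using (Complex.reCLM : ℂ →L[ℝ] ℝ).lipschitz.weaken Complex.reCLM_norm.le
  have hcomp := hre.comp (lipschitzWith_of_nnnorm_fderiv_le hEd (C := Real.toNNReal
    (2 * Real.pi * ‖latticeVec m‖ * Ĉ)) fun y => ?_)
  · simpa using hcomp
  rw [← NNReal.coe_le_coe, coe_nnnorm, Real.coe_toNNReal _ hC0]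
  refine ContinuousLinearMap.opNorm_le_bound _ hC0 fun v => ?_
  have h1 : ‖lift (phaseFactor m D θ) y‖ = 1 := by rw [lift_apply]; exact norm_phaseFactor m D θ _
  rw [fderiv_lift_phaseFactor_apply hD y v, norm_mul, h1, one_mul, norm_mul, Complex.norm_I,
    mul_one, Complex.norm_real, Real.norm_eq_abs, fderiv_lift, ← norm_mul_inner_dirVec, abs_mul,
    abs_mul, abs_mul, abs_two, abs_of_pos Real.pi_pos, abs_of_nonneg (norm_nonneg _)]
  have h2 : |⟪dirVec m D (proj y), v⟫_ℝ| ≤ Ĉ * ‖v‖ :=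
    (abs_real_inner_le_norm _ _).trans
      (mul_le_mul_of_nonneg_right (norm_dirVec_le hND hm _) (norm_nonneg _))
  calc 2 * Real.pi * (‖latticeVec m‖ * |⟪dirVec m D (proj y), v⟫_ℝ|)
      ≤ 2 * Real.pi * (‖latticeVec m‖ * (Ĉ * ‖v‖)) := by gcongr
    _ = 2 * Real.pi * ‖latticeVec m‖ * Ĉ * ‖v‖ := by ring

/-- **`‖cos(ψ+θ)‖_{C^{0,α}} ≤ (2πĈ + 3) |m|^α`** for `α ≤ 1` (the factor `λ^α` of the stationary
phase lemma, "`[e^{iλφ}]_α ≲ λ^α`"): sup norm `≤ 1 ≤ |m|^α`, and the Hölder seminorm by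
interpolation at scale `|m|⁻¹` between the Lipschitz bound `2π|m|Ĉ` and the oscillation bound `2`
(`holderWith_of_lipschitzWith_of_edist_le`). [folklore] -/
theorem eContDiffHolderNorm_phaseCos_le (hĈ : 1 ≤ Ĉ) (hD : IsSmooth D)
    (hND : IsNondegenerateDisplacement Ĉ D) (hm : m ≠ 0) (θ : ℝ) {α : ℝ≥0} (hα : α ≤ 1) :
    Torus.eContDiffHolderNorm 0 α (phaseCos m D θ) ≤
      ENNReal.ofReal (2 * Real.pi * Ĉ + 3) * freqPow m α := by
  have hC : 0 < Ĉ := lt_of_lt_of_le one_pos hĈ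
  set M : ℝ := ‖latticeVec m‖ with hM
  have hM1 : 1 ≤ M := one_le_norm_latticeVec hm
  have hM0 : 0 < M := lt_of_lt_of_le one_pos hM1
  -- sup norm
  have hsup : eSupNorm (lift (phaseCos m D θ)) ≤ 1 := by
    have := eSupNorm_le_ofReal (g := lift (phaseCos m D θ)) (M := 1) fun y => by
      rw [lift_apply, Real.norm_eq_abs]; exact abs_phaseCos_le_one m D θ _
    rwa [ENNReal.ofReal_one] at this
  -- Hölder seminorm by interpolation at scale `δ = M⁻¹`
  have hL := lipschitzWith_lift_phaseCos hĈ hD hND hm θ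
  have hB : ∀ y z, edist (lift (phaseCos m D θ) y) (lift (phaseCos m D θ) z) ≤ (2 : ℝ≥0) := by
    intro y z
    rw [edist_dist, dist_eq_norm, Real.norm_eq_abs]
    have h : |lift (phaseCos m D θ) y - lift (phaseCos m D θ) z| ≤ 2 := by
      rw [lift_apply, lift_apply]
      have h1 := abs_phaseCos_le_one m D θ (proj y)
      have h2 := abs_phaseCos_le_one m D θ (proj z)
      exact (abs_sub _ _).trans (by linarith)
    calc ENNReal.ofReal |lift (phaseCos m D θ) y - lift (phaseCos m D θ) z|
        ≤ ENNReal.ofReal 2 := ENNReal.ofReal_le_ofReal h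
      _ = (2 : ℝ≥0) := by rw [ENNReal.ofReal_ofNat]; rfl
  set δ : ℝ≥0 := (Real.toNNReal M)⁻¹ with hδ
  have hδ0 : 0 < δ := by
    rw [hδ, inv_pos, Real.toNNReal_pos]; exact hM0
  have hH := (holderWith_of_lipschitzWith_of_edist_le hL hB hα hδ0).eHolderNorm_le
  -- the constant: `L δ^{1-α} + 2 δ⁻¹^α = (2πĈ + 2) M^α`
  have hconst : ((Real.toNNReal (2 * Real.pi * ‖latticeVec m‖ * Ĉ) * δ ^ (1 - α : ℝ) +
      2 * δ⁻¹ ^ (α : ℝ) : ℝ≥0) : ℝ≥0∞) = ENNReal.ofReal ((2 * Real.pi * Ĉ + 2) * M ^ (α : ℝ)) := by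
    rw [← hM]
    have hδr : (δ : ℝ) = M⁻¹ := by
      rw [hδ, NNReal.coe_inv, Real.coe_toNNReal _ hM0.le]
    have hreal : ((Real.toNNReal (2 * Real.pi * M * Ĉ) * δ ^ (1 - α : ℝ) +
        2 * δ⁻¹ ^ (α : ℝ) : ℝ≥0) : ℝ) = (2 * Real.pi * Ĉ + 2) * M ^ (α : ℝ) := by
      push_cast
      rw [Real.coe_toNNReal _ (by positivity), hδr, inv_inv, Real.inv_rpow hM0.le,
        Real.rpow_sub hM0, Real.rpow_one]
      have hMa : 0 < M ^ (α : ℝ) := Real.rpow_pos_of_pos hM0 _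
      field_simp
    rw [← hreal, ENNReal.ofReal_coe_nnreal]
  -- assemble
  unfold Torus.eContDiffHolderNorm
  rw [eContDiffHolderNorm_zero_eq]
  have hpow : freqPow m α = ENNReal.ofReal (M ^ (α : ℝ)) := by
    rw [freqPow, hM, norm_latticeVec_eq_sqrt]
  have hMa1 : 1 ≤ M ^ (α : ℝ) := Real.one_le_rpow hM1 α.2
  calc eSupNorm (lift (phaseCos m D θ)) + eHolderNorm α (lift (phaseCos m D θ))
      ≤ 1 + ENNReal.ofReal ((2 * Real.pi * Ĉ + 2) * M ^ (α : ℝ)) :=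
        add_le_add hsup (hH.trans (le_of_eq hconst))
    _ ≤ ENNReal.ofReal (M ^ (α : ℝ)) + ENNReal.ofReal ((2 * Real.pi * Ĉ + 2) * M ^ (α : ℝ)) := by
        gcongr
        rw [← ENNReal.ofReal_one]
        exact ENNReal.ofReal_le_ofReal hMa1
    _ = ENNReal.ofReal (2 * Real.pi * Ĉ + 3) * freqPow m α := by
        rw [hpow, ← ENNReal.ofReal_add (by positivity) (by positivity),
          ← ENNReal.ofReal_mul (by positivity)]
        congr 1
        ring

/-! ### `ℛ` of the telescoped sum: reduction to Hölder bounds of the mode tensors -/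

/-- `ℛ` of a finite sum of smooth fields is the sum of the `ℛ`'s (`Torus.antidivergence_add`).
[folklore] -/
theorem antidivergence_finset_sum {ι : Type*} (s : Finset ι) {v : ι → 𝕋³ → ℝ³}
    (hv : ∀ i ∈ s, IsSmooth (v i)) :
    Torus.antidivergence (∑ i ∈ s, v i) = ∑ i ∈ s, Torus.antidivergence (v i) := by
  classical
  induction s using Finset.induction_on with
  | empty =>
      simp only [Finset.sum_empty]
      exact Torus.antidivergence_zero
  | insert a s ha ih =>
      have hs : IsSmooth (∑ i ∈ s, v i) := by
        have : IsSmooth (fun x => ∑ i ∈ s, v i x) := by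
          unfold IsSmooth Torus.lift
          simp only [Function.comp_def]
          exact ContDiff.sum fun i hi => hv i (Finset.mem_insert_of_mem hi)
        convert this using 1
        funext x
        simp [Finset.sum_apply]
      rw [Finset.sum_insert ha, Finset.sum_insert ha,
        Torus.antidivergence_add (hv a (Finset.mem_insert_self a s)) hs,
        ih fun i hi => hv i (Finset.mem_insert_of_mem hi)]

/-- **The Schauder step** (Daneri–Székelyhidi, proof of Lemma 2.2 (ii): "According to standard
Schauder estimates, `[∇u]_α ≤ C λ⁻¹Σ_{n<N} λ^{-n}[aₙ∇φ/|∇φ|² e^{iλφ}]_α + λ^{-N}[a_N e^{iλφ}]_α + …`"),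
here directly for `ℛ`: with `C_d`, `C_r` the constants of `‖ℛ div A‖_{0,α} ≤ C_d ‖A‖_{0,α}` and
`‖ℛ v‖_{0,α} ≤ C_r ‖v‖_{0,α}` (`BDSV.holder_antidivergence_tensorDivergence_le`,
`BDSV.holder_antidivergence_le`),
`‖ℛ(cos(ψ+θ) a)‖_{0,α} ≤ C_d ∑_{n<N} ‖(F cos(ψ+θₙ)) ⊗ Lⁿa‖_{0,α} + C_r ‖cos(ψ+θ_N) Lᴺa‖_{0,α}`,
`θₙ = θ + nπ/2 - π/2`, `θ_N = θ + Nπ/2`. [cite: DaneriSzekelyhidi2017, Lemma 2.2 (proof)] -/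
theorem antidivergence_phaseCos_smul_le (hĈ : 1 ≤ Ĉ) (hD : IsSmooth D)
    (hND : IsNondegenerateDisplacement Ĉ D) (hm : m ≠ 0) (θ : ℝ) {a : 𝕋³ → ℝ³} (ha : IsSmooth a)
    {α : ℝ≥0} {Cd Cr : ℝ≥0}
    (hCd : ∀ A : 𝕋³ → Fin 3 → ℝ³, IsSmooth A →
      Torus.eContDiffHolderNorm 0 α (Torus.antidivergence (Torus.tensorDivergence A)) ≤
        Cd * Torus.eContDiffHolderNorm 0 α A)
    (hCr : ∀ v : 𝕋³ → ℝ³, IsSmooth v →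
      Torus.eContDiffHolderNorm 0 α (Torus.antidivergence v) ≤ Cr * Torus.eContDiffHolderNorm 0 α v)
    (N : ℕ) :
    Torus.eContDiffHolderNorm 0 α (Torus.antidivergence fun x => phaseCos m D θ x • a x) ≤
      Cd * ∑ n ∈ Finset.range N, Torus.eContDiffHolderNorm 0 α
          (modeTensor m D (θ + n * (Real.pi / 2) - Real.pi / 2) ((ibpOpVec m D)^[n] a)) +
        Cr * Torus.eContDiffHolderNorm 0 α
          (fun x => phaseCos m D (θ + N * (Real.pi / 2)) x • ((ibpOpVec m D)^[N] a) x) := by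
  -- the summands and their smoothness
  set T : ℕ → 𝕋³ → Fin 3 → ℝ³ := fun n =>
    modeTensor m D (θ + n * (Real.pi / 2) - Real.pi / 2) ((ibpOpVec m D)^[n] a) with hT
  set R : 𝕋³ → ℝ³ := fun x => phaseCos m D (θ + N * (Real.pi / 2)) x • ((ibpOpVec m D)^[N] a) x
    with hR
  have hTs : ∀ n, IsSmooth (T n) := fun n =>
    isSmooth_modeTensor hĈ hD hND hm _ (isSmooth_iterate_ibpOpVec hĈ hD hND hm ha n)
  have hdivs : ∀ n, IsSmooth (Torus.tensorDivergence (T n)) := fun n => (hTs n).tensorDivergence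
  have hRs : IsSmooth R := (isSmooth_phaseCos m hD _).smul' (isSmooth_iterate_ibpOpVec hĈ hD hND hm ha N)
  -- the decomposition as an identity of functions
  have hdec : (fun x => phaseCos m D θ x • a x) =
      (∑ n ∈ Finset.range N, Torus.tensorDivergence (T n)) + R := by
    funext x
    rw [phaseCos_smul_eq_sum hĈ hD hND hm θ ha N x, Pi.add_apply, Finset.sum_apply]
  have hsum : IsSmooth (∑ n ∈ Finset.range N, Torus.tensorDivergence (T n)) := by
    have : IsSmooth (fun x => ∑ n ∈ Finset.range N, Torus.tensorDivergence (T n) x) := by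
      unfold IsSmooth Torus.lift
      simp only [Function.comp_def]
      exact ContDiff.sum fun n _ => hdivs n
    convert this using 1
    funext x
    simp [Finset.sum_apply]
  rw [hdec, Torus.antidivergence_add hsum hRs, antidivergence_finset_sum _ fun n _ => hdivs n]
  -- triangle inequality and the two operator bounds
  have hRa : ∀ n, IsSmooth (Torus.antidivergence (Torus.tensorDivergence (T n))) := fun n =>
    Torus.isSmooth_antidivergence (hdivs n)
  have hS1 : IsSmooth (∑ n ∈ Finset.range N, Torus.antidivergence (Torus.tensorDivergence (T n))) := by
    have : IsSmooth (fun x => ∑ n ∈ Finset.range N,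
        Torus.antidivergence (Torus.tensorDivergence (T n)) x) := by
      unfold IsSmooth Torus.lift
      simp only [Function.comp_def]
      exact ContDiff.sum fun n _ => hRa n
    convert this using 1
    funext x
    simp [Finset.sum_apply]
  have hS2 : IsSmooth (Torus.antidivergence R) := Torus.isSmooth_antidivergence hRs
  calc Torus.eContDiffHolderNorm 0 α
        (∑ n ∈ Finset.range N, Torus.antidivergence (Torus.tensorDivergence (T n)) +
          Torus.antidivergence R)
      ≤ Torus.eContDiffHolderNorm 0 α
            (∑ n ∈ Finset.range N, Torus.antidivergence (Torus.tensorDivergence (T n))) +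
          Torus.eContDiffHolderNorm 0 α (Torus.antidivergence R) :=
        Torus.eContDiffHolderNorm_add_le (hS1.isContDiff (by simp)) (hS2.isContDiff (by simp))
    _ ≤ (∑ n ∈ Finset.range N,
          Torus.eContDiffHolderNorm 0 α (Torus.antidivergence (Torus.tensorDivergence (T n)))) +
          Torus.eContDiffHolderNorm 0 α (Torus.antidivergence R) := by
        gcongr
        exact Torus.eContDiffHolderNorm_sum_le _ fun n _ => (hRa n).isContDiff (by simp)
    _ ≤ (∑ n ∈ Finset.range N, Cd * Torus.eContDiffHolderNorm 0 α (T n)) +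
          Cr * Torus.eContDiffHolderNorm 0 α R :=
        add_le_add (Finset.sum_le_sum fun n _ => hCd _ (hTs n)) (hCr _ hRs)
    _ = Cd * ∑ n ∈ Finset.range N, Torus.eContDiffHolderNorm 0 α (T n) +
          Cr * Torus.eContDiffHolderNorm 0 α R := by
        rw [Finset.mul_sum]

/-! ### Order-zero bookkeeping: sharp product, columns, the field `F` -/

/-- **Sharp product rule at order zero** on the torus (BDSV App. A (A.2) with `r ∈ [0,1]`, in the
form where only one factor carries the Hölder exponent):
`‖f • g‖_{C^{0,r}} ≤ ‖f‖_∞ ‖g‖_{C^{0,r}} + ‖f‖_{C^{0,r}} ‖g‖_∞` (`eHolderNorm_bilinear_le`). [folklore] -/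
theorem eContDiffHolderNorm_zero_smul_le_sharp {Y : Type*} [NormedAddCommGroup Y] [NormedSpace ℝ Y]
    (r : ℝ≥0) (f : 𝕋³ → ℝ) (g : 𝕋³ → Y) :
    Torus.eContDiffHolderNorm 0 r (fun x => f x • g x) ≤
      eSupNorm f * Torus.eContDiffHolderNorm 0 r g + Torus.eContDiffHolderNorm 0 r f * eSupNorm g := by
  unfold Torus.eContDiffHolderNorm
  rw [eContDiffHolderNorm_zero_eq, eContDiffHolderNorm_zero_eq, eContDiffHolderNorm_zero_eq,
    ← eSupNorm_lift f, ← eSupNorm_lift g]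
  have hlift : lift (fun x => f x • g x) = fun y => lift f y • lift g y := rfl
  rw [hlift]
  have h1 := eSupNorm_smul_le (lift f) (lift g)
  have h2 := eHolderNorm_bilinear_le (ContinuousLinearMap.lsmul ℝ ℝ : ℝ →L[ℝ] Y →L[ℝ] Y) r
    (lift f) (lift g)
  have hB : ‖(ContinuousLinearMap.lsmul ℝ ℝ : ℝ →L[ℝ] Y →L[ℝ] Y)‖ₑ ≤ 1 := by
    rw [enorm_eq_nnnorm, ← ENNReal.coe_one, ENNReal.coe_le_coe, ← NNReal.coe_le_coe, coe_nnnorm]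
    exact ContinuousLinearMap.opNorm_lsmul_le
  simp only [ContinuousLinearMap.lsmul_apply] at h2
  calc eSupNorm (fun y => lift f y • lift g y) + eHolderNorm r (fun y => lift f y • lift g y)
      ≤ eSupNorm (lift f) * eSupNorm (lift g) +
          1 * (eHolderNorm r (lift f) * eSupNorm (lift g) + eSupNorm (lift f) * eHolderNorm r (lift g)) :=
        add_le_add h1 (h2.trans (mul_le_mul_of_nonneg_right hB bot_le))
    _ ≤ eSupNorm (lift f) * (eSupNorm (lift g) + eHolderNorm r (lift g)) +
          (eSupNorm (lift f) + eHolderNorm r (lift f)) * eSupNorm (lift g) := by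
        rw [one_mul, mul_add, add_mul]
        -- `a b + (c b + a d) ≤ (a b + a d) + (a b + c b)`
        calc eSupNorm (lift f) * eSupNorm (lift g) +
              (eHolderNorm r (lift f) * eSupNorm (lift g) + eSupNorm (lift f) * eHolderNorm r (lift g))
            = (eSupNorm (lift f) * eSupNorm (lift g) + eSupNorm (lift f) * eHolderNorm r (lift g)) +
                eHolderNorm r (lift f) * eSupNorm (lift g) := by ring
          _ ≤ _ := add_le_add le_rfl le_add_self

/-- Columns bound a tensor field: `‖S‖_{C^{0,r}} ≤ ∑ₗ ‖S·ₗ‖_{C^{0,r}}` for continuous `S`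
(`S = Σₗ singleₗ ∘ S·ₗ`, each `singleₗ` of norm `≤ 1`). [folklore] -/
theorem eContDiffHolderNorm_zero_le_sum_columns (r : ℝ≥0) {S : 𝕋³ → Fin 3 → ℝ³}
    (hS : ∀ l, IsContDiff ((0 : ℕ) : WithTop ℕ∞) (fun x => S x l)) :
    Torus.eContDiffHolderNorm 0 r S ≤ ∑ l, Torus.eContDiffHolderNorm 0 r (fun x => S x l) := by
  classical
  set L : Fin 3 → (ℝ³ →L[ℝ] (Fin 3 → ℝ³)) := fun l =>
    ContinuousLinearMap.single ℝ (fun _ : Fin 3 => ℝ³) l with hL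
  have hdec : S = ∑ l, fun x => L l (S x l) := by
    funext x
    simp only [Finset.sum_apply, hL, ContinuousLinearMap.single_apply]
    exact (Finset.univ_sum_single (S x)).symm
  have hLn : ∀ l, ‖L l‖₊ ≤ 1 := fun l => by
    rw [← NNReal.coe_le_coe, coe_nnnorm, NNReal.coe_one]
    refine ContinuousLinearMap.opNorm_le_bound _ zero_le_one fun v => ?_
    rw [hL, ContinuousLinearMap.single_apply, Pi.norm_single, one_mul]
  have hsm : ∀ l, IsContDiff ((0 : ℕ) : WithTop ℕ∞) (fun x => L l (S x l)) := fun l =>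
    (L l).contDiff.comp (hS l)
  calc Torus.eContDiffHolderNorm 0 r S
      = Torus.eContDiffHolderNorm 0 r (∑ l, fun x => L l (S x l)) := by rw [← hdec]
    _ ≤ ∑ l, Torus.eContDiffHolderNorm 0 r (fun x => L l (S x l)) :=
        Torus.eContDiffHolderNorm_sum_le _ fun l _ => hsm l
    _ ≤ ∑ l, Torus.eContDiffHolderNorm 0 r (fun x => S x l) := by
        refine Finset.sum_le_sum fun l _ => ?_
        calc Torus.eContDiffHolderNorm 0 r (fun x => L l (S x l))
            ≤ ‖L l‖₊ * Torus.eContDiffHolderNorm 0 r (fun x => S x l) :=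
              Torus.eContDiffHolderNorm_zero_clm_comp_le (L l) r _
          _ ≤ 1 * Torus.eContDiffHolderNorm 0 r (fun x => S x l) := by
              gcongr; exact_mod_cast hLn l
          _ = _ := one_mul _

/-- **The mode tensor in `C^{0,r}`**:
`‖(F cos) ⊗ b‖_{0,r} ≤ ∑ₗ (‖Fₗ cos‖_∞ ‖b‖_{0,r} + ‖Fₗ cos‖_{0,r} ‖b‖_∞)`. [folklore] -/
theorem eContDiffHolderNorm_modeTensor_le (hĈ : 1 ≤ Ĉ) (hD : IsSmooth D)
    (hND : IsNondegenerateDisplacement Ĉ D) (hm : m ≠ 0) (θ' : ℝ) {b : 𝕋³ → ℝ³} (hb : IsSmooth b)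
    (r : ℝ≥0) :
    Torus.eContDiffHolderNorm 0 r (modeTensor m D θ' b) ≤
      ∑ l, (eSupNorm (fun x => ibpField m D l x * phaseCos m D θ' x) * Torus.eContDiffHolderNorm 0 r b +
        Torus.eContDiffHolderNorm 0 r (fun x => ibpField m D l x * phaseCos m D θ' x) * eSupNorm b) := by
  have hcol : ∀ l, IsSmooth (fun x => modeTensor m D θ' b x l) := fun l =>
    (isSmooth_mul (isSmooth_ibpField hĈ hD hND hm l) (isSmooth_phaseCos m hD θ')).smul' hb
  refine (eContDiffHolderNorm_zero_le_sum_columns r fun l => (hcol l).isContDiff (by simp)).trans ?_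
  exact Finset.sum_le_sum fun l _ => eContDiffHolderNorm_zero_smul_le_sharp r _ b

/-- `v ↦ v/|v|²` is `3Ĉ⁴`-Lipschitz on the shell `Ĉ⁻¹ ≤ |v| ≤ Ĉ` (`Ĉ ≥ 1`; pointwise in the two
arguments, no convexity needed: `v/|v|² - w/|w|² = (v-w)/|v|² + (|v|⁻² - |w|⁻²) w`). [folklore] -/
theorem norm_recipVec_sub_le (hĈ : 1 ≤ Ĉ) {v w : ℝ³} (hv : Ĉ⁻¹ ≤ ‖v‖) (hv' : ‖v‖ ≤ Ĉ)
    (hw : Ĉ⁻¹ ≤ ‖w‖) (hw' : ‖w‖ ≤ Ĉ) : ‖recipVec v - recipVec w‖ ≤ 3 * Ĉ ^ 4 * ‖v - w‖ := by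
  have hC : 0 < Ĉ := lt_of_lt_of_le one_pos hĈ
  have hv0 : 0 < ‖v‖ := lt_of_lt_of_le (inv_pos.2 hC) hv
  have hw0 : 0 < ‖w‖ := lt_of_lt_of_le (inv_pos.2 hC) hw
  have hvi : ‖v‖⁻¹ ≤ Ĉ := by rw [inv_le_comm₀ hv0 hC]; exact hv
  have hwi : ‖w‖⁻¹ ≤ Ĉ := by rw [inv_le_comm₀ hw0 hC]; exact hw
  -- `v/|v|² - w/|w|² = (v - w)/|v|² + w (1/|v|² - 1/|w|²)`
  have hdec : recipVec v - recipVec w =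
      (‖v‖ ^ 2)⁻¹ • (v - w) + ((‖v‖ ^ 2)⁻¹ - (‖w‖ ^ 2)⁻¹) • w := by
    simp only [recipVec, smul_sub, sub_smul]
    abel
  have h1 : ‖(‖v‖ ^ 2)⁻¹ • (v - w)‖ ≤ Ĉ ^ 2 * ‖v - w‖ := by
    rw [norm_smul, norm_inv, norm_pow, norm_norm, ← inv_pow]
    exact mul_le_mul_of_nonneg_right (pow_le_pow_left₀ (inv_nonneg.2 hv0.le) hvi 2) (norm_nonneg _)
  have h2 : ‖((‖v‖ ^ 2)⁻¹ - (‖w‖ ^ 2)⁻¹) • w‖ ≤ 2 * Ĉ ^ 4 * ‖v - w‖ := by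
    rw [norm_smul, Real.norm_eq_abs]
    have hid : (‖v‖ ^ 2)⁻¹ - (‖w‖ ^ 2)⁻¹ = (‖w‖ - ‖v‖) * (‖w‖ + ‖v‖) * ((‖v‖ ^ 2)⁻¹ * (‖w‖ ^ 2)⁻¹) := by
      field_simp
      ring
    rw [hid, abs_mul, abs_mul, abs_of_pos (by positivity : 0 < (‖v‖ ^ 2)⁻¹ * (‖w‖ ^ 2)⁻¹),
      abs_of_pos (by positivity : 0 < ‖w‖ + ‖v‖)]
    have h3 : |‖w‖ - ‖v‖| ≤ ‖v - w‖ := by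
      rw [abs_sub_comm]; exact abs_norm_sub_norm_le v w
    have h4 : ‖w‖ + ‖v‖ ≤ 2 * Ĉ := by linarith
    have h5 : (‖v‖ ^ 2)⁻¹ * (‖w‖ ^ 2)⁻¹ * ‖w‖ ≤ Ĉ ^ 3 := by
      have : (‖w‖ ^ 2)⁻¹ * ‖w‖ = ‖w‖⁻¹ := by field_simp
      rw [mul_assoc, this, ← inv_pow]
      calc ‖v‖⁻¹ ^ 2 * ‖w‖⁻¹ ≤ Ĉ ^ 2 * Ĉ :=
            mul_le_mul (pow_le_pow_left₀ (inv_nonneg.2 hv0.le) hvi 2) hwi (inv_nonneg.2 hw0.le)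
              (by positivity)
        _ = Ĉ ^ 3 := by ring
    calc |‖w‖ - ‖v‖| * (‖w‖ + ‖v‖) * ((‖v‖ ^ 2)⁻¹ * (‖w‖ ^ 2)⁻¹) * ‖w‖
        = |‖w‖ - ‖v‖| * (‖w‖ + ‖v‖) * ((‖v‖ ^ 2)⁻¹ * (‖w‖ ^ 2)⁻¹ * ‖w‖) := by ring
      _ ≤ ‖v - w‖ * (2 * Ĉ) * Ĉ ^ 3 := by
          gcongr
      _ = 2 * Ĉ ^ 4 * ‖v - w‖ := by ring
  calc ‖recipVec v - recipVec w‖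
      = ‖(‖v‖ ^ 2)⁻¹ • (v - w) + ((‖v‖ ^ 2)⁻¹ - (‖w‖ ^ 2)⁻¹) • w‖ := by rw [hdec]
    _ ≤ Ĉ ^ 2 * ‖v - w‖ + 2 * Ĉ ^ 4 * ‖v - w‖ := (norm_add_le _ _).trans (add_le_add h1 h2)
    _ ≤ Ĉ ^ 4 * ‖v - w‖ + 2 * Ĉ ^ 4 * ‖v - w‖ :=
        add_le_add_left (mul_le_mul_of_nonneg_right
          (pow_le_pow_right₀ hĈ (by norm_num : 2 ≤ 4)) (norm_nonneg _)) _
    _ = 3 * Ĉ ^ 4 * ‖v - w‖ := by ring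

/-- The Hölder seminorm of the lifted direction field: `[dirVec]_r ≤ [D(lift D)]_r ≤ ‖D‖_{C^{1,r}}`
(`dirVec = m̂ + (∇D)ᵀm̂`, `|m̂| = 1`). [folklore] -/
theorem eHolderNorm_lift_dirVec_le (r : ℝ≥0) (hm : m ≠ 0) :
    eHolderNorm r (lift (dirVec m D)) ≤ Torus.eContDiffHolderNorm 1 r D := by
  have h1 : eHolderNorm r (lift (dirVec m D)) =
      eHolderNorm r (fun y => adjApply (unitFreq m) (fderiv ℝ (lift D) y)) := by
    refine eHolderNorm_congr_edist r fun y z => ?_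
    rw [lift_dirVec]
    simp only [edist_add_left]
  have h2 : eHolderNorm r (fun y => adjApply (unitFreq m) (fderiv ℝ (lift D) y)) ≤
      (1 : ℝ≥0) * eHolderNorm r (fderiv ℝ (lift D)) := by
    refine Torus.eHolderNorm_comp_le_mul r ?_ (fderiv ℝ (lift D))
    have := (adjApply (unitFreq m)).lipschitz
    refine this.weaken ?_
    rw [← NNReal.coe_le_coe, coe_nnnorm, NNReal.coe_one]
    exact (opNorm_adjApply_le _).trans (norm_unitFreq hm).le
  rw [h1]
  refine (h2.trans ?_)
  rw [ENNReal.coe_one, one_mul]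
  unfold Torus.eContDiffHolderNorm
  rw [eContDiffHolderNorm_one_eq, eHolderNorm_iteratedFDeriv_succ_eq_fderiv,
    eHolderNorm_iteratedFDeriv_zero]
  exact le_add_self

/-- **The field `F` at order zero, sup norm**: `‖Fₗ‖_∞ ≤ Ĉ/(2π|m|)` (`BDSV.abs_ibpField_le`).
[folklore] -/
theorem eSupNorm_ibpField_le (hĈ : 1 ≤ Ĉ) (hND : IsNondegenerateDisplacement Ĉ D) (hm : m ≠ 0)
    (l : Fin 3) :
    eSupNorm (ibpField m D l) ≤ ENNReal.ofReal ((2 * Real.pi * ‖latticeVec m‖)⁻¹ * Ĉ) :=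
  eSupNorm_le_ofReal fun x => by
    rw [Real.norm_eq_abs]; exact abs_ibpField_le hĈ hND hm l x

/-- **The field `F` at order zero, Hölder norm**:
`‖Fₗ‖_{C^{0,r}} ≤ (2π|m|)⁻¹ (Ĉ + 3Ĉ⁴ ‖D‖_{C^{1,r}})` (`Fₗ = (2π|m|)⁻¹ (dirVec/|dirVec|²)ₗ`, the
shell bounds `Ĉ⁻¹ ≤ |dirVec| ≤ Ĉ`, `BDSV.norm_recipVec_sub_le`, `BDSV.eHolderNorm_lift_dirVec_le`).
[folklore] -/
theorem eContDiffHolderNorm_ibpField_le (hĈ : 1 ≤ Ĉ) (hND : IsNondegenerateDisplacement Ĉ D)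
    (hm : m ≠ 0) (l : Fin 3) (r : ℝ≥0) :
    Torus.eContDiffHolderNorm 0 r (ibpField m D l) ≤
      ENNReal.ofReal ((2 * Real.pi * ‖latticeVec m‖)⁻¹ * Ĉ) +
        ENNReal.ofReal ((2 * Real.pi * ‖latticeVec m‖)⁻¹ * (3 * Ĉ ^ 4)) *
          Torus.eContDiffHolderNorm 1 r D := by
  have hC : 0 < Ĉ := lt_of_lt_of_le one_pos hĈ
  have hc : 0 < (2 * Real.pi * ‖latticeVec m‖)⁻¹ := by
    have := norm_latticeVec_pos hm; positivity
  unfold Torus.eContDiffHolderNorm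
  rw [eContDiffHolderNorm_zero_eq, eSupNorm_lift]
  refine add_le_add (eSupNorm_ibpField_le hĈ hND hm l) ?_
  -- the Hölder seminorm: `Fₗ∘lift = c (recipVec ∘ lift dirVec)ₗ`, Lipschitz post-composition
  have hshell : ∀ y, Ĉ⁻¹ ≤ ‖lift (dirVec m D) y‖ ∧ ‖lift (dirVec m D) y‖ ≤ Ĉ := fun y => by
    rw [lift_apply]; exact ⟨inv_le_norm_dirVec hĈ hND hm _, norm_dirVec_le hND hm _⟩
  have hincr : ∀ y z, edist (lift (ibpField m D l) y) (lift (ibpField m D l) z) ≤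
      ENNReal.ofReal ((2 * Real.pi * ‖latticeVec m‖)⁻¹ * (3 * Ĉ ^ 4)) *
        edist (lift (dirVec m D) y) (lift (dirVec m D) z) := by
    intro y z
    rw [edist_dist, edist_dist, ← ENNReal.ofReal_mul (by positivity), dist_eq_norm, dist_eq_norm]
    refine ENNReal.ofReal_le_ofReal ?_
    rw [lift_ibpField]
    simp only [Function.comp_apply]
    rw [← mul_sub, norm_mul, Real.norm_eq_abs, abs_of_pos hc]
    have hcomp : ‖recipVec (lift (dirVec m D) y) l - recipVec (lift (dirVec m D) z) l‖ ≤
        ‖recipVec (lift (dirVec m D) y) - recipVec (lift (dirVec m D) z)‖ := by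
      rw [← PiLp.sub_apply]
      exact PiLp.norm_apply_le _ l
    calc (2 * Real.pi * ‖latticeVec m‖)⁻¹ *
          ‖recipVec (lift (dirVec m D) y) l - recipVec (lift (dirVec m D) z) l‖
        ≤ (2 * Real.pi * ‖latticeVec m‖)⁻¹ *
            (3 * Ĉ ^ 4 * ‖lift (dirVec m D) y - lift (dirVec m D) z‖) :=
          mul_le_mul_of_nonneg_left (hcomp.trans (norm_recipVec_sub_le hĈ (hshell y).1
            (hshell y).2 (hshell z).1 (hshell z).2)) hc.le
      _ = _ := by ring
  -- from the increment bound to the seminorm bound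
  have hH : eHolderNorm r (lift (ibpField m D l)) ≤
      ENNReal.ofReal ((2 * Real.pi * ‖latticeVec m‖)⁻¹ * (3 * Ĉ ^ 4)) *
        eHolderNorm r (lift (dirVec m D)) := by
    by_cases hmem : MemHolder r (lift (dirVec m D))
    · have hHW := hmem.holderWith
      refine (HolderWith.eHolderNorm_le (C := Real.toNNReal ((2 * Real.pi * ‖latticeVec m‖)⁻¹ *
        (3 * Ĉ ^ 4)) * nnHolderNorm r (lift (dirVec m D))) fun y z => ?_).trans (le_of_eq ?_)
      · calc edist (lift (ibpField m D l) y) (lift (ibpField m D l) z)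
            ≤ ENNReal.ofReal ((2 * Real.pi * ‖latticeVec m‖)⁻¹ * (3 * Ĉ ^ 4)) *
                edist (lift (dirVec m D) y) (lift (dirVec m D) z) := hincr y z
          _ ≤ ENNReal.ofReal ((2 * Real.pi * ‖latticeVec m‖)⁻¹ * (3 * Ĉ ^ 4)) *
                ((nnHolderNorm r (lift (dirVec m D)) : ℝ≥0∞) * edist y z ^ (r : ℝ)) :=
              mul_le_mul_of_nonneg_left (hHW y z) bot_le
          _ = _ := by rw [ENNReal.coe_mul, ENNReal.ofReal]; ring
      · rw [ENNReal.coe_mul, hmem.coe_nnHolderNorm_eq_eHolderNorm, ENNReal.ofReal]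
    · have htop : eHolderNorm r (lift (dirVec m D)) = ⊤ := by
        rwa [← eHolderNorm_ne_top, not_ne_iff] at hmem
      rw [htop, ENNReal.mul_top (by positivity)]
      exact le_top
  exact hH.trans (mul_le_mul_of_nonneg_left (eHolderNorm_lift_dirVec_le r hm) bot_le)

/-! ### Components of the vector iterates; the product `Fₗ cos`; the combined reduction -/

/-- The vector iterates are the scalar iterates of the components: `(Lⁿ a)ᵢ = Lⁿ (aᵢ)` (so the
bounds of part II on `(BDSV.ibpOp m D)^[n]` apply componentwise). [folklore] -/
theorem iterate_ibpOpVec_apply (a : 𝕋³ → ℝ³) :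
    ∀ (n : ℕ) (x : 𝕋³) (i : Fin 3),
      ((ibpOpVec m D)^[n] a) x i = ((ibpOp m D)^[n] fun y => a y i) x
  | 0, x, i => rfl
  | n + 1, x, i => by
      rw [Function.iterate_succ_apply', Function.iterate_succ_apply', ibpOpVec, PiLp.toLp_apply]
      congr 1
      funext y
      exact iterate_ibpOpVec_apply a n y i

/-- `‖cos(ψ+θ)‖_∞ ≤ 1` (on the torus). [folklore] -/
theorem eSupNorm_phaseCos_le (m : Fin 3 → ℤ) (D : 𝕋³ → ℝ³) (θ : ℝ) :
    eSupNorm (phaseCos m D θ) ≤ 1 := by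
  have := eSupNorm_le_ofReal (g := phaseCos m D θ) (M := 1) fun x => by
    rw [Real.norm_eq_abs]; exact abs_phaseCos_le_one m D θ x
  rwa [ENNReal.ofReal_one] at this

/-- **The product `Fₗ cos(ψ+θ')` at order zero, sup norm**: `‖Fₗ cos‖_∞ ≤ Ĉ/(2π|m|)`. [folklore] -/
theorem eSupNorm_ibpField_mul_phaseCos_le (hĈ : 1 ≤ Ĉ) (hND : IsNondegenerateDisplacement Ĉ D)
    (hm : m ≠ 0) (l : Fin 3) (θ' : ℝ) :
    eSupNorm (fun x => ibpField m D l x * phaseCos m D θ' x) ≤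
      ENNReal.ofReal ((2 * Real.pi * ‖latticeVec m‖)⁻¹ * Ĉ) := by
  have hC : 0 < Ĉ := lt_of_lt_of_le one_pos hĈ
  refine eSupNorm_le_ofReal fun x => ?_
  rw [norm_mul, Real.norm_eq_abs, Real.norm_eq_abs]
  have h1 := abs_ibpField_le hĈ hND hm l x
  have h2 := abs_phaseCos_le_one m D θ' x
  have h0 : 0 ≤ (2 * Real.pi * ‖latticeVec m‖)⁻¹ * Ĉ := by
    have := norm_latticeVec_pos hm; positivity
  calc |ibpField m D l x| * |phaseCos m D θ' x| ≤ (2 * Real.pi * ‖latticeVec m‖)⁻¹ * Ĉ * 1 :=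
        mul_le_mul h1 h2 (abs_nonneg _) h0
    _ = _ := mul_one _

/-- **The product `Fₗ cos(ψ+θ')` at order zero, Hölder norm** (`r ≤ 1`):
`‖Fₗ cos‖_{C^{0,r}} ≤ (Ĉ/(2π|m|)) (2πĈ+3)|m|^r + (2π|m|)⁻¹(Ĉ + 3Ĉ⁴‖D‖_{C^{1,r}})` (sharp product,
`BDSV.eContDiffHolderNorm_phaseCos_le`, `BDSV.eContDiffHolderNorm_ibpField_le`). [folklore] -/
theorem eContDiffHolderNorm_ibpField_mul_phaseCos_le (hĈ : 1 ≤ Ĉ) (hD : IsSmooth D)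
    (hND : IsNondegenerateDisplacement Ĉ D) (hm : m ≠ 0) (l : Fin 3) (θ' : ℝ) {r : ℝ≥0}
    (hr : r ≤ 1) :
    Torus.eContDiffHolderNorm 0 r (fun x => ibpField m D l x * phaseCos m D θ' x) ≤
      ENNReal.ofReal ((2 * Real.pi * ‖latticeVec m‖)⁻¹ * Ĉ) *
          (ENNReal.ofReal (2 * Real.pi * Ĉ + 3) * freqPow m r) +
        (ENNReal.ofReal ((2 * Real.pi * ‖latticeVec m‖)⁻¹ * Ĉ) +
          ENNReal.ofReal ((2 * Real.pi * ‖latticeVec m‖)⁻¹ * (3 * Ĉ ^ 4)) *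
            Torus.eContDiffHolderNorm 1 r D) := by
  have h := eContDiffHolderNorm_zero_smul_le_sharp r (ibpField m D l) (phaseCos m D θ')
  simp only [smul_eq_mul] at h
  refine h.trans (add_le_add ?_ ?_)
  · exact mul_le_mul' (eSupNorm_ibpField_le hĈ hND hm l)
      (eContDiffHolderNorm_phaseCos_le hĈ hD hND hm θ' hr)
  · calc Torus.eContDiffHolderNorm 0 r (ibpField m D l) * eSupNorm (phaseCos m D θ')
        ≤ Torus.eContDiffHolderNorm 0 r (ibpField m D l) * 1 :=
          mul_le_mul_of_nonneg_left (eSupNorm_phaseCos_le m D θ') bot_le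
      _ ≤ _ := by rw [mul_one]; exact eContDiffHolderNorm_ibpField_le hĈ hND hm l r

/-- **The `ℛ` estimate of Prop. C.2 reduced to bounds on the iterates `Lⁿa`** (the telescoping
identity, the Schauder step and the order-zero bookkeeping of the factors `F`, `cos` combined; what
remains of Daneri–Székelyhidi's proof is their tame bound (E:a_N2) on `aₙ = Lⁿa` and the final
interpolation): with `C_d`, `C_r` the operator constants of `ℛ div`, `ℛ` on `C^{0,α}` (`α ≤ 1`) and
`c = (2π|m|)⁻¹`,
`‖ℛ(cos(ψ+θ) a)‖_{0,α} ≤ C_d ∑_{n<N} ∑ₗ (c Ĉ ‖Lⁿa‖_{0,α} + (c Ĉ (2πĈ+3)|m|^α + c(Ĉ + 3Ĉ⁴‖D‖_{1,α})) ‖Lⁿa‖_∞)`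
`  + C_r (‖Lᴺa‖_{0,α} + (2πĈ+3)|m|^α ‖Lᴺa‖_∞)`.
[cite: BuckmasterEtAl2018, App. C Prop. C.2] -/
theorem antidivergence_phaseCos_smul_le_iterates (hĈ : 1 ≤ Ĉ) (hD : IsSmooth D)
    (hND : IsNondegenerateDisplacement Ĉ D) (hm : m ≠ 0) (θ : ℝ) {a : 𝕋³ → ℝ³} (ha : IsSmooth a)
    {α : ℝ≥0} (hα : α ≤ 1) {Cd Cr : ℝ≥0}
    (hCd : ∀ A : 𝕋³ → Fin 3 → ℝ³, IsSmooth A →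
      Torus.eContDiffHolderNorm 0 α (Torus.antidivergence (Torus.tensorDivergence A)) ≤
        Cd * Torus.eContDiffHolderNorm 0 α A)
    (hCr : ∀ v : 𝕋³ → ℝ³, IsSmooth v →
      Torus.eContDiffHolderNorm 0 α (Torus.antidivergence v) ≤ Cr * Torus.eContDiffHolderNorm 0 α v)
    (N : ℕ) :
    Torus.eContDiffHolderNorm 0 α (Torus.antidivergence fun x => phaseCos m D θ x • a x) ≤
      Cd * ∑ n ∈ Finset.range N, ∑ _l : Fin 3,
          (ENNReal.ofReal ((2 * Real.pi * ‖latticeVec m‖)⁻¹ * Ĉ) *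
              Torus.eContDiffHolderNorm 0 α ((ibpOpVec m D)^[n] a) +
            (ENNReal.ofReal ((2 * Real.pi * ‖latticeVec m‖)⁻¹ * Ĉ) *
                (ENNReal.ofReal (2 * Real.pi * Ĉ + 3) * freqPow m α) +
              (ENNReal.ofReal ((2 * Real.pi * ‖latticeVec m‖)⁻¹ * Ĉ) +
                ENNReal.ofReal ((2 * Real.pi * ‖latticeVec m‖)⁻¹ * (3 * Ĉ ^ 4)) *
                  Torus.eContDiffHolderNorm 1 α D)) *
              eSupNorm ((ibpOpVec m D)^[n] a)) +
        Cr * (Torus.eContDiffHolderNorm 0 α ((ibpOpVec m D)^[N] a) +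
          ENNReal.ofReal (2 * Real.pi * Ĉ + 3) * freqPow m α * eSupNorm ((ibpOpVec m D)^[N] a)) := by
  refine (antidivergence_phaseCos_smul_le hĈ hD hND hm θ ha hCd hCr N).trans (add_le_add ?_ ?_)
  · refine mul_le_mul_of_nonneg_left (Finset.sum_le_sum fun n _ => ?_) bot_le
    have hb := isSmooth_iterate_ibpOpVec hĈ hD hND hm ha n
    refine (eContDiffHolderNorm_modeTensor_le hĈ hD hND hm _ hb α).trans
      (Finset.sum_le_sum fun l _ => add_le_add ?_ ?_)
    · exact mul_le_mul_of_nonneg_right (eSupNorm_ibpField_mul_phaseCos_le hĈ hND hm l _) bot_le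
    · exact mul_le_mul_of_nonneg_right
        (eContDiffHolderNorm_ibpField_mul_phaseCos_le hĈ hD hND hm l _ hα) bot_le
  · refine mul_le_mul_of_nonneg_left ?_ bot_le
    have hb := isSmooth_iterate_ibpOpVec hĈ hD hND hm ha N
    refine (eContDiffHolderNorm_zero_smul_le_sharp α (phaseCos m D _) ((ibpOpVec m D)^[N] a)).trans
      (add_le_add ?_ ?_)
    · calc eSupNorm (phaseCos m D (θ + N * (Real.pi / 2))) *
            Torus.eContDiffHolderNorm 0 α ((ibpOpVec m D)^[N] a)
          ≤ 1 * Torus.eContDiffHolderNorm 0 α ((ibpOpVec m D)^[N] a) :=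
            mul_le_mul_of_nonneg_right (eSupNorm_phaseCos_le m D _) bot_le
        _ = _ := one_mul _
    · exact mul_le_mul_of_nonneg_right (eContDiffHolderNorm_phaseCos_le hĈ hD hND hm _ hα) bot_le


/-- **The reduction with the proved operator constants**: for `0 < α < 1` there are `C_d`, `C_r`
(from `BDSV.holderCZBound_holds` through `BDSV.holder_antidivergence_tensorDivergence_le` and
`BDSV.holder_antidivergence_le`) for which the bound of
`BDSV.antidivergence_phaseCos_smul_le_iterates` holds for all smooth non-degenerate `D`, `m ≠ 0`, `θ`,
smooth `a` and all `N`. [cite: BuckmasterEtAl2018, App. C Prop. C.2] -/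
theorem antidivergence_phaseCos_smul_le_iterates' {α : ℝ≥0} (hα0 : 0 < α) (hα1 : α < 1) :
    ∃ Cd Cr : ℝ≥0, ∀ Ĉ : ℝ, 1 ≤ Ĉ → ∀ D : 𝕋³ → ℝ³, IsSmooth D → IsNondegenerateDisplacement Ĉ D →
      ∀ m : Fin 3 → ℤ, m ≠ 0 → ∀ (θ : ℝ) (a : 𝕋³ → ℝ³), IsSmooth a → ∀ N : ℕ,
        Torus.eContDiffHolderNorm 0 α (Torus.antidivergence fun x => phaseCos m D θ x • a x) ≤
          Cd * ∑ n ∈ Finset.range N, ∑ _l : Fin 3,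
              (ENNReal.ofReal ((2 * Real.pi * ‖latticeVec m‖)⁻¹ * Ĉ) *
                  Torus.eContDiffHolderNorm 0 α ((ibpOpVec m D)^[n] a) +
                (ENNReal.ofReal ((2 * Real.pi * ‖latticeVec m‖)⁻¹ * Ĉ) *
                    (ENNReal.ofReal (2 * Real.pi * Ĉ + 3) * freqPow m α) +
                  (ENNReal.ofReal ((2 * Real.pi * ‖latticeVec m‖)⁻¹ * Ĉ) +
                    ENNReal.ofReal ((2 * Real.pi * ‖latticeVec m‖)⁻¹ * (3 * Ĉ ^ 4)) *
                      Torus.eContDiffHolderNorm 1 α D)) *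
                  eSupNorm ((ibpOpVec m D)^[n] a)) +
            Cr * (Torus.eContDiffHolderNorm 0 α ((ibpOpVec m D)^[N] a) +
              ENNReal.ofReal (2 * Real.pi * Ĉ + 3) * freqPow m α *
                eSupNorm ((ibpOpVec m D)^[N] a)) := by
  obtain ⟨Cd, hCd⟩ := holder_antidivergence_tensorDivergence_le holderCZBound_holds hα0 hα1
  obtain ⟨Cr, hCr⟩ := holder_antidivergence_le holderCZBound_holds hα0 hα1
  exact ⟨Cd, Cr, fun Ĉ hĈ D hD hND m hm θ a ha N =>
    antidivergence_phaseCos_smul_le_iterates hĈ hD hND hm θ ha hα1.le hCd hCr N⟩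

end BDSV

end Literature.Analysis.FluidPDE
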